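import Mathlib.LinearAlgebra.Dual.Lemmas
import Mathlib.LinearAlgebra.Basis.VectorSpace
import Mathlib.Algebra.Module.LocalizedModule.Submodule
import Mathlib.RingTheory.Localization.FractionRing
import Mathlib.RingTheory.Localization.Integer
import Mathlib.RingTheory.Localization.Module
import Mathlib.RingTheory.Finiteness.Projective
import Mathlib.Algebra.Homology.ShortComplex.ModuleCat
import Literature.RingTheory.CohomologyAnnihilator.SyzygyBasic
import HarnessLib

/-!
# Second syzygies over a domain are reflexive (CA-layer target CA0 of chain W4.4)

`[OURS · L W4.4 ∩ W4.4b]` Crux `HomologicalConductor.NoZenoR` (stmt-ResolutionOfSingularities-19943),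
line `sandwich-cluster`, S3 Layer 2, CA-layer target **CA0** of res-L0-w44-plan-1's CRUX-PLAN v5 §A
(typed sketch `L/res-L0-w44-plan-1/SketchCALayer.lean`, tri-1 A-audit PASS); consumed a second time by
rung S-2 `HomologicalConductor.PersistenceSurface` (stmt-ResolutionOfSingularities-19970), programme M-rat,
hypothesis (IW-p) (res-L1-w44b-plan-1 CRUX-PLAN v5 §4.2 (R4)). Replaces the role of no printed item of the
manuscript under review; pure commutative algebra; AI-written (weaker than expert review).

## What is proved (no noetherian and NO NORMALITY hypothesis is needed)

Over a commutative DOMAIN `T`: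

* `exists_dual_comp_subtype_eq_smul` — a functional on a submodule `K` of a finitely generated projective
  module `F` extends to `F` after scaling by a nonzero `d : T` (pass to the fraction field, extend over the
  field, clear denominators on a basis);
* `dualMap_dualMap_subtype_injective` — hence `K** → F**` is injective;
* `isReflexive_ker` — the kernel of a linear map from a finitely generated projective module to a module
  whose points are separated by functionals (e.g. a projective module, `separating_of_injective`) is
  REFLEXIVE (`Module.IsReflexive`: `Dual.eval` bijective);
* `isReflexive_of_isSyzygy_two` — **CA0**: every second syzygy module (`IsSyzygy 2 M K` of
  `Literature/RingTheory/CohomologyAnnihilator/StrongGenerator.lean`) is reflexive; the planner's typed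
  signature (noetherian normal domain, `M` finitely generated) is the corollary
  `isReflexive_of_isSyzygy_two_of_isIntegrallyClosed` with its idle hypotheses kept for the consumer.

The classical route (torsion-free + Serre's `(S₂)`, `M = ⋂_{ht 𝔭 = 1} M_𝔭` over a NORMAL noetherian domain,
Bruns–Herzog 1.4.1 / Stacks 0AV0) is not needed: a second syzygy is a kernel `K = ker (F → N)` with `F`
finitely generated projective and `N ↪ P'` projective, and for such kernels reflexivity follows from
`F ≅ F**`, separation of the points of `N` by functionals, and the injectivity of `K** → F**`, which over a
domain holds because `coker (F* → K*)` is torsion. [folklore; cf. Bruns–Herzog, *Cohen–Macaulay rings*,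
Prop. 1.4.1 and Exercise 1.4.20]
-/

-- single-problem summit: the doubled namespace component `ResolutionOfSingularities` is forced
set_option linter.dupNamespace false

noncomputable section

open Module Function

universe u v w

namespace Summit.ResolutionOfSingularities.ResolutionOfSingularities.Theorems.NoZeno.SandwichCluster

section Free

variable {T : Type u} [CommRing T] [IsDomain T]
variable {F : Type v} [AddCommGroup F] [Module T F]

/-- Over a domain, every functional on a submodule `K` of a finitely generated FREE module `F` extends to
`F` after scaling by a nonzero element: `∃ d ≠ 0, ∃ l : F →ₗ T, l|_K = d • κ` (extend `κ ⊗ Frac T` over the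
fraction field and clear denominators on a basis of `F`). [folklore] -/
theorem exists_dual_comp_subtype_eq_smul_of_free [Module.Finite T F] [Module.Free T F]
    (K : Submodule T F) (κ : Dual T K) :
    ∃ d : T, d ≠ 0 ∧ ∃ l : Dual T F, l ∘ₗ K.subtype = d • κ := by
  classical
  let S := nonZeroDivisors T
  let L := FractionRing T
  let V := LocalizedModule S F
  let f : F →ₗ[T] V := LocalizedModule.mkLinearMap S F
  let K' : Submodule L V := K.localized' L S f
  let g : K →ₗ[T] K' := K.toLocalized' L S f
  -- extend `κ` to the localisation `K'` of `K`, `T`-linearly and then `L`-linearly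
  let κL : K →ₗ[T] L := (Algebra.linearMap T L) ∘ₗ κ
  let κT : K' →ₗ[T] L :=
    IsLocalizedModule.lift S g κL (IsLocalizedModule.map_units (Algebra.linearMap T L))
  have hκT : ∀ k : K, κT (g k) = algebraMap T L (κ k) := fun k =>
    IsLocalizedModule.lift_apply S g κL _ k
  let κ' : K' →ₗ[L] L := κT.extendScalarsOfIsLocalization S L
  -- extend to the whole vector space `V`
  obtain ⟨Λ, hΛ⟩ := LinearMap.exists_extend (p := K') κ'
  let ΛT : F →ₗ[T] L := (Λ.restrictScalars T) ∘ₗ f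
  have hΛT : ∀ k : K, ΛT (k : F) = algebraMap T L (κ k) := by
    intro k
    have h1 : f (k : F) = K'.subtype (g k) := rfl
    have h2 : Λ (K'.subtype (g k)) = κ' (g k) := LinearMap.congr_fun hΛ (g k)
    change Λ (f (k : F)) = _
    rw [h1, h2]
    exact hκT k
  -- clear denominators on a basis of `F`
  let b := Module.Free.chooseBasis T F
  haveI : Fintype (Module.Free.ChooseBasisIndex T F) := Module.Free.ChooseBasisIndex.fintype T F
  obtain ⟨d, hd⟩ := IsLocalization.exist_integer_multiples_of_finite S (fun i => ΛT (b i))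
  have hd' : ∀ i, ∃ c : T, algebraMap T L c = (d : T) • ΛT (b i) := fun i => hd i
  choose c hc using hd'
  refine ⟨d, nonZeroDivisors.coe_ne_zero d, b.constr T c, ?_⟩
  have key : (Algebra.linearMap T L) ∘ₗ (b.constr T c) = (d : T) • ΛT := by
    refine b.ext fun i => ?_
    simp only [LinearMap.coe_comp, Function.comp_apply, Algebra.linearMap_apply, Basis.constr_basis,
      LinearMap.smul_apply]
    exact hc i
  ext k
  apply IsFractionRing.injective T L
  have h1 := LinearMap.congr_fun key (k : F)
  simp only [LinearMap.coe_comp, Function.comp_apply, Algebra.linearMap_apply,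
    LinearMap.smul_apply] at h1
  rw [LinearMap.comp_apply, Submodule.subtype_apply, h1, hΛT k, LinearMap.smul_apply, smul_eq_mul,
    map_mul, Algebra.smul_def]

/-- Over a domain, for a submodule `K` of a finitely generated free module `F` the double dual of the
inclusion, `K** → F**`, is injective (its kernel is the dual of the torsion module `coker (F* → K*)`).
[folklore] -/
theorem dualMap_dualMap_subtype_injective_of_free [Module.Finite T F] [Module.Free T F]
    (K : Submodule T F) : Injective K.subtype.dualMap.dualMap := by
  rw [injective_iff_map_eq_zero]
  intro ψ hψ
  ext κ
  obtain ⟨d, hd, l, hl⟩ := exists_dual_comp_subtype_eq_smul_of_free K κ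
  have h1 : ψ (l ∘ₗ K.subtype) = 0 := by
    exact LinearMap.congr_fun hψ l
  rw [hl, map_smul, smul_eq_mul] at h1
  exact (mul_eq_zero.mp h1).resolve_left hd

/-- Over a domain, the kernel of a linear map from a finitely generated free module to a module whose
points are separated by functionals is reflexive. [folklore] -/
theorem isReflexive_ker_of_free [Module.Finite T F] [Module.Free T F]
    {N : Type w} [AddCommGroup N] [Module T N]
    (hN : ∀ n : N, n ≠ 0 → ∃ μ : Dual T N, μ n ≠ 0) (φ : F →ₗ[T] N) :
    IsReflexive T (LinearMap.ker φ) := by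
  set K := LinearMap.ker φ
  have hinjF : Injective (Dual.eval T F) := eval_apply_injective T
  have hnat : K.subtype.dualMap.dualMap ∘ₗ Dual.eval T K = Dual.eval T F ∘ₗ K.subtype :=
    Dual.eval_naturality K.subtype
  refine ⟨⟨?_, ?_⟩⟩
  · have h : Injective (Dual.eval T F ∘ₗ K.subtype) := by
      rw [LinearMap.coe_comp]
      exact hinjF.comp K.injective_subtype
    rw [← hnat, LinearMap.coe_comp] at h
    exact h.of_comp
  · intro ψ
    obtain ⟨x, hx⟩ := (bijective_dual_eval T F).2 (K.subtype.dualMap.dualMap ψ)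
    have hxK : x ∈ K := by
      rw [LinearMap.mem_ker]
      by_contra hne
      obtain ⟨μ, hμ⟩ := hN _ hne
      apply hμ
      have h2 : (μ ∘ₗ φ) ∘ₗ K.subtype = 0 := by
        ext k
        simp [K]
      have h1 : Dual.eval T F x (μ ∘ₗ φ) = ψ ((μ ∘ₗ φ) ∘ₗ K.subtype) := by
        rw [hx]
        rfl
      rw [h2, map_zero] at h1
      simpa using h1
    refine ⟨⟨x, hxK⟩, ?_⟩
    apply dualMap_dualMap_subtype_injective_of_free K
    rw [← hx]
    exact LinearMap.congr_fun hnat ⟨x, hxK⟩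

end Free

section Projective

variable {T : Type u} [CommRing T] [IsDomain T]
variable {F : Type v} [AddCommGroup F] [Module T F]

omit [IsDomain T] in
/-- Points of a projective module are separated by functionals (Mathlib
`Module.Projective.exists_dual_ne_zero`, restated in the shape used below). [folklore] -/
theorem separating_of_projective {N : Type w} [AddCommGroup N] [Module T N] [Projective T N] :
    ∀ n : N, n ≠ 0 → ∃ μ : Dual T N, μ n ≠ 0 :=
  fun _ hn => Projective.exists_dual_ne_zero T hn

omit [IsDomain T] in
/-- Separation by functionals passes to a module mapping injectively to a separated one. [folklore] -/
theorem separating_of_injective {N : Type w} [AddCommGroup N] [Module T N]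
    {N' : Type*} [AddCommGroup N'] [Module T N'] (ι : N →ₗ[T] N') (hι : Injective ι)
    (hN' : ∀ n : N', n ≠ 0 → ∃ μ : Dual T N', μ n ≠ 0) :
    ∀ n : N, n ≠ 0 → ∃ μ : Dual T N, μ n ≠ 0 := by
  intro n hn
  obtain ⟨μ, hμ⟩ := hN' (ι n) ((map_ne_zero_iff ι hι).mpr hn)
  exact ⟨μ ∘ₗ ι, hμ⟩

/-- **Kernels out of finitely generated projectives are reflexive over a domain.** For a commutative
domain `T`, a finitely generated projective `F`, a module `N` whose points are separated by functionals,
and `φ : F →ₗ N`, the module `ker φ` is reflexive. (Reduce to `F` free: `F` is a retract `r ∘ s = id` of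
`Tⁿ`, and `ker φ ≅ ker (y ↦ (φ (r y), y - s (r y)))`.) [folklore] -/
theorem isReflexive_ker [Module.Finite T F] [Projective T F]
    {N : Type w} [AddCommGroup N] [Module T N]
    (hN : ∀ n : N, n ≠ 0 → ∃ μ : Dual T N, μ n ≠ 0) (φ : F →ₗ[T] N) :
    IsReflexive T (LinearMap.ker φ) := by
  obtain ⟨n, r, s, -, -, hrs⟩ := Module.Finite.exists_comp_eq_id_of_projective T F
  let φ' : (Fin n → T) →ₗ[T] N × (Fin n → T) := (φ ∘ₗ r).prod (LinearMap.id - s ∘ₗ r)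
  have hsep : ∀ z : N × (Fin n → T), z ≠ 0 → ∃ μ : Dual T (N × (Fin n → T)), μ z ≠ 0 := by
    rintro ⟨a, y⟩ hz
    by_cases ha : a = 0
    · subst ha
      have hy : y ≠ 0 := fun hy => hz (by simp [hy])
      obtain ⟨μ, hμ⟩ := separating_of_projective (T := T) y hy
      exact ⟨μ ∘ₗ LinearMap.snd T N (Fin n → T), by simpa using hμ⟩
    · obtain ⟨μ, hμ⟩ := hN a ha
      exact ⟨μ ∘ₗ LinearMap.fst T N (Fin n → T), by simpa using hμ⟩
  have hK' : IsReflexive T (LinearMap.ker φ') := isReflexive_ker_of_free hsep φ'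
  have hrs' : ∀ x : F, r (s x) = x := fun x => LinearMap.congr_fun hrs x
  have hmem : ∀ y : Fin n → T, y ∈ LinearMap.ker φ' ↔ φ (r y) = 0 ∧ y - s (r y) = 0 := fun y => by
    rw [LinearMap.mem_ker]
    change ((φ (r y), y - s (r y)) : N × (Fin n → T)) = 0 ↔ _
    exact Prod.mk_eq_zero
  -- `ker φ' ≃ ker φ` via `r` and `s`
  let toK : LinearMap.ker φ' →ₗ[T] LinearMap.ker φ :=
    (r ∘ₗ (LinearMap.ker φ').subtype).codRestrict (LinearMap.ker φ) fun y => by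
      rw [LinearMap.mem_ker]
      exact ((hmem y.1).mp y.2).1
  let toK' : LinearMap.ker φ →ₗ[T] LinearMap.ker φ' :=
    (s ∘ₗ (LinearMap.ker φ).subtype).codRestrict (LinearMap.ker φ') fun x => by
      have hx : φ (x : F) = 0 := (LinearMap.mem_ker).mp x.2
      rw [hmem]
      constructor
      · change φ (r (s (x : F))) = 0
        rw [hrs', hx]
      · change s (x : F) - s (r (s (x : F))) = 0
        rw [hrs', sub_self]
  haveI := hK'
  refine Module.equiv (LinearEquiv.ofLinear toK toK' ?_ ?_)
  · refine LinearMap.ext fun x => Subtype.ext ?_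
    change r (s (x : F)) = x
    exact hrs' x
  · refine LinearMap.ext fun y => Subtype.ext ?_
    change s (r (y : Fin n → T)) = y
    exact (sub_eq_zero.mp ((hmem y.1).mp y.2).2).symm

end Projective

section Syzygy

open CategoryTheory Literature.RingTheory.CohomologyAnnihilator

variable {T : Type u} [CommRing T] [IsDomain T]

/-- **CA0 over any domain: second syzygies are reflexive.** If `K` is a second syzygy module of `M`
(`IsSyzygy 2 M K`: exact `0 → K → P → K' → 0` and `0 → K' → P' → K'' ≅ M` with `P`, `P'` finitely generated
projective), then `K` is reflexive. No finiteness of `M`, no noetherian and no normality hypothesis.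
[folklore; cf. Bruns–Herzog Prop. 1.4.1] -/
theorem isReflexive_of_isSyzygy_two (M K : ModuleCat.{u} T) (hK : IsSyzygy 2 M K) :
    IsReflexive T K := by
  obtain ⟨K', P, hK', hPfin, hPproj, f, g, w, hS⟩ := hK
  obtain ⟨K'', P', -, -, hP'proj, f', g', w', hS'⟩ := hK'
  haveI : Module.Finite T P := hPfin
  haveI : Module.Projective T P := moduleProjective_of_projective P hPproj
  haveI : Module.Projective T P' := moduleProjective_of_projective P' hP'proj
  -- points of `K'` are separated by functionals: `K' ↪ P'` projective
  have hsep : ∀ y : K', y ≠ 0 → ∃ μ : Dual T K', μ y ≠ 0 :=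
    separating_of_injective f'.hom hS'.moduleCat_injective_f separating_of_projective
  -- `K ≅ range f = ker g`
  have hrange : LinearMap.range f.hom = LinearMap.ker g.hom := hS.exact.moduleCat_range_eq_ker
  have e : K ≃ₗ[T] LinearMap.ker g.hom :=
    (LinearEquiv.ofInjective f.hom hS.moduleCat_injective_f).trans (LinearEquiv.ofEq _ _ hrange)
  haveI := isReflexive_ker hsep g.hom
  exact Module.equiv e.symm

/-- **CA0 in the planner's typed signature** (res-L0-w44-plan-1 `SketchCALayer.lean`,
`isReflexive_of_isSyzygy_two`): over a noetherian normal domain every second syzygy of a finitely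
generated module is reflexive. The hypotheses `IsNoetherianRing`, `IsIntegrallyClosed`, `Module.Finite T M`
are idle (kept for the consumer's shape; see `isReflexive_of_isSyzygy_two`). [folklore] -/
theorem isReflexive_of_isSyzygy_two_of_isIntegrallyClosed [IsNoetherianRing T] [IsIntegrallyClosed T]
    (M K : ModuleCat.{u} T) (_hM : Module.Finite T M) (hK : IsSyzygy 2 M K) :
    Module.IsReflexive T K :=
  isReflexive_of_isSyzygy_two M K hK

end Syzygy

end Summit.ResolutionOfSingularities.ResolutionOfSingularities.Theorems.NoZeno.SandwichCluster

end
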